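import Summits.CriticalPhenomena.Ising3D.TaylorTable
import Literature.MathematicalPhysics.QuantumFieldTheory.ConformalBootstrap3D.PointKernelInterval
import Literature.MathematicalPhysics.QuantumFieldTheory.ConformalBootstrap3D.PointKernelArith
import Literature.MathematicalPhysics.QuantumFieldTheory.ConformalBootstrap3D.HRCoeffCellBounds
import Mathlib.Tactic.Linarith
import Mathlib.Tactic.Positivity
import Mathlib.Tactic.Ring
import HarnessLib

/-!
# The TABLE layer of a derivative certificate, VII: the even coefficient enclosures are decidable
(cell `pub-ising3x`, seat boot-1 gen 6; gate (g2) — discharging the even half of `TaylorTable.Enclosures`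
from the tree's rational coefficient tables)

HONEST FRAMING: lottery ticket; floor = tightest certified 3D Ising CFT bounds; no exact-solution
claim without a proof.

The even head cells of a `TaylorTable` carry, per head term `(n, j)`, a rational interval claimed to
contain `A_{n,j}(Δ,ℓ)/λ_ℓ` for every `Δ` in the cell `[lo, hi]` (hypothesis `T.Enclosures`, first
conjunct). This file makes that hypothesis a Boolean: `evenEnclEntryOK` compares the claimed interval with
the tree's Δ-uniform coefficient bounds — for `ℓ = 0` (cells above `½`) the INTERVAL-RECURSION tables
`hrCoeffLo/Hi` of `HRCoeffIntervalBounds` through their rational mirrors `PointKernel.hrCoeffLoQ/HiQ`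
(`hrCoeff_mem_Icc_interval`), for `ℓ ≥ 1` (cells from `ℓ + 1` on, the bound included) the MONOTONE cell
rule of `HRCoeffCellBounds` (`hrCoeff_cell_lower/upper`: endpoint values times the pivot-product ratio)
through `PointKernel.hrCoeffQ` / `pivotProdQ`; `λ_ℓ` through `PointKernel.legendreLamQ`. THEOREM
`TaylorTable.evenEnclosures_of_check`: if every even cell passes `evenEnclOK` then the even conjunct of
`T.Enclosures` holds — so, with `TaylorTableTheorem`, everything but the odd (`hrCoeffAB`) enclosures and
the two region layers is decided by the kernel. Sources: Hogervorst–Rychkov 2013 §3 eq. (3.9). Elementary.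
-/

namespace Summit.CriticalPhenomena.Ising3D

open Finset Set
open Literature.MathematicalPhysics.QuantumFieldTheory.ConformalBootstrap3D
open Literature.MathematicalPhysics.QuantumFieldTheory.ConformalBootstrap3D.PointKernel
  (hrCoeffQ pivotProdQ legendreLamQ hrCoeffLoQ hrCoeffHiQ cast_hrCoeffQ cast_pivotProdQ cast_legendreLamQ
    cast_hrCoeffLoQ cast_hrCoeffHiQ)

/-- Per-entry check of an even coefficient enclosure `I ∋ A_{n,j}(Δ,ℓ)/λ_ℓ` on `[lo, hi]`: interval rule
at `ℓ = 0` (needs `½ < lo`), monotone cell rule at `ℓ ≥ 1` (needs `ℓ + 1 ≤ lo`). [folklore] -/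
def evenEnclEntryOK (ℓ : ℕ) (lo hi : ℚ) (q : ℕ × ℕ) (I : ℚ × ℚ) : Bool :=
  if ℓ = 0 then
    decide (1 / 2 < lo) && decide (I.1 ≤ hrCoeffLoQ lo hi 0 q.1 q.2 / legendreLamQ 0) &&
      decide (hrCoeffHiQ lo hi 0 q.1 q.2 / legendreLamQ 0 ≤ I.2)
  else
    decide ((ℓ : ℚ) + 1 ≤ lo) &&
      decide (I.1 ≤ hrCoeffQ lo ℓ q.1 q.2 * (pivotProdQ lo ℓ q.1 / pivotProdQ hi ℓ q.1) / legendreLamQ ℓ) &&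
      decide (hrCoeffQ hi ℓ q.1 q.2 * (pivotProdQ hi ℓ q.1 / pivotProdQ lo ℓ q.1) / legendreLamQ ℓ ≤ I.2)

/-- **Soundness of the per-entry check.** [cite: HogervorstRychkov2013, §3 eq. (3.9)] -/
theorem evenEnclEntryOK_sound {ℓ : ℕ} {lo hi : ℚ} {q : ℕ × ℕ} {I : ℚ × ℚ}
    (h : evenEnclEntryOK ℓ lo hi q I = true) {Δ : ℝ} (h1 : (lo : ℝ) ≤ Δ) (h2 : Δ ≤ hi) :
    (I.1 : ℝ) ≤ hrCoeff Δ ℓ q.1 q.2 / legendreLam ℓ ∧ hrCoeff Δ ℓ q.1 q.2 / legendreLam ℓ ≤ (I.2 : ℝ) := by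
  have hlam : 0 < legendreLam ℓ := legendreLam_pos ℓ
  unfold evenEnclEntryOK at h
  split_ifs at h with hℓ
  · subst hℓ
    simp only [Bool.and_eq_true, decide_eq_true_eq] at h
    obtain ⟨⟨hlo, hL⟩, hU⟩ := h
    have hb : unitarityBound3D 0 < (lo : ℝ) := by
      have : unitarityBound3D 0 = 1 / 2 := by simp [unitarityBound3D]
      rw [this]
      have h' : ((1 / 2 : ℚ) : ℝ) < (lo : ℝ) := by exact_mod_cast hlo
      push_cast at h'
      exact h'
    obtain ⟨_, hlow, hupp⟩ := hrCoeff_mem_Icc_interval hb h1 h2 q.1 q.2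
    have hL' : ((I.1 : ℚ) : ℝ) ≤ ((hrCoeffLoQ lo hi 0 q.1 q.2 / legendreLamQ 0 : ℚ) : ℝ) := by exact_mod_cast hL
    have hU' : ((hrCoeffHiQ lo hi 0 q.1 q.2 / legendreLamQ 0 : ℚ) : ℝ) ≤ ((I.2 : ℚ) : ℝ) := by exact_mod_cast hU
    rw [Rat.cast_div, cast_hrCoeffLoQ, cast_legendreLamQ] at hL'
    rw [Rat.cast_div, cast_hrCoeffHiQ, cast_legendreLamQ] at hU'
    exact ⟨hL'.trans (div_le_div_of_nonneg_right hlow hlam.le), (div_le_div_of_nonneg_right hupp hlam.le).trans hU'⟩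
  · simp only [Bool.and_eq_true, decide_eq_true_eq] at h
    obtain ⟨⟨hlo, hL⟩, hU⟩ := h
    have hb : (ℓ : ℝ) + 1 ≤ (lo : ℝ) := by
      have : (((ℓ : ℚ) + 1 : ℚ) : ℝ) ≤ (lo : ℝ) := by exact_mod_cast hlo
      push_cast at this; exact this
    have hlow := hrCoeff_cell_lower hb h1 h2 q.1 q.2
    have hupp := hrCoeff_cell_upper hb h1 h2 q.1 q.2
    have hL' : ((I.1 : ℚ) : ℝ) ≤
        ((hrCoeffQ lo ℓ q.1 q.2 * (pivotProdQ lo ℓ q.1 / pivotProdQ hi ℓ q.1) / legendreLamQ ℓ : ℚ) : ℝ) := by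
      exact_mod_cast hL
    have hU' : ((hrCoeffQ hi ℓ q.1 q.2 * (pivotProdQ hi ℓ q.1 / pivotProdQ lo ℓ q.1) / legendreLamQ ℓ : ℚ) : ℝ) ≤
        ((I.2 : ℚ) : ℝ) := by exact_mod_cast hU
    rw [Rat.cast_div, Rat.cast_mul, Rat.cast_div, cast_hrCoeffQ, cast_pivotProdQ, cast_pivotProdQ,
      cast_legendreLamQ] at hL' hU'
    exact ⟨hL'.trans (div_le_div_of_nonneg_right hlow hlam.le), (div_le_div_of_nonneg_right hupp hlam.le).trans hU'⟩

/-- Per-cell check: the claimed enclosures `A` (aligned with `F`) all pass. [folklore] -/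
def evenEnclOK (C : EvenCellData) : Bool :=
  decide (C.A.length = C.F.length) && (List.zip C.F C.A).all fun p => evenEnclEntryOK C.ℓ C.lo C.hi p.1 p.2

/-- **Soundness of the per-cell check**: the even conjunct of `TaylorTable.Enclosures` for this cell.
[cite: HogervorstRychkov2013, §3 eq. (3.9)] -/
theorem evenEnclOK_sound {C : EvenCellData} (h : evenEnclOK C = true) :
    ∀ Δ : ℝ, (C.lo : ℝ) ≤ Δ → Δ ≤ C.hi → ∀ (i : ℕ) (q : ℕ × ℕ) (I : ℚ × ℚ),
      C.F[i]? = some q → C.A[i]? = some I →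
      (I.1 : ℝ) ≤ hrCoeff Δ C.ℓ q.1 q.2 / legendreLam C.ℓ ∧ hrCoeff Δ C.ℓ q.1 q.2 / legendreLam C.ℓ ≤ (I.2 : ℝ) := by
  intro Δ h1 h2 i q I hq hI
  simp only [evenEnclOK, Bool.and_eq_true, decide_eq_true_eq, List.all_eq_true] at h
  obtain ⟨_, hall⟩ := h
  have hmem : (q, I) ∈ List.zip C.F C.A :=
    List.mem_iff_getElem?.mpr ⟨i, by rw [List.getElem?_zip_eq_some]; exact ⟨hq, hI⟩⟩
  exact evenEnclEntryOK_sound (hall _ hmem) h1 h2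

namespace TaylorTable

/-- **The even coefficient enclosures of a table are decidable**: if every even cell passes `evenEnclOK`
then the even conjunct of `T.Enclosures` holds. [cite: HogervorstRychkov2013, §3 eq. (3.9)] -/
theorem evenEnclosures_of_check (T : TaylorTable) (h : T.evenCells.all evenEnclOK = true) :
    ∀ C ∈ T.evenCells, ∀ Δ : ℝ, (C.lo : ℝ) ≤ Δ → Δ ≤ C.hi → ∀ (i : ℕ) (q : ℕ × ℕ) (I : ℚ × ℚ),
      C.F[i]? = some q → C.A[i]? = some I →
      (I.1 : ℝ) ≤ hrCoeff Δ C.ℓ q.1 q.2 / legendreLam C.ℓ ∧ hrCoeff Δ C.ℓ q.1 q.2 / legendreLam C.ℓ ≤ (I.2 : ℝ) := by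
  rw [List.all_eq_true] at h
  intro C hC
  exact evenEnclOK_sound (h C hC)

/-- **Table theorem with decidable even enclosures**: only the odd (`hrCoeffAB`) enclosures and the two
region layers remain as hypotheses. [cite: KosPolandSimmonsduffin2014, §3.3 eq. (3.16)] -/
theorem enclosures_of_even_check (T : TaylorTable) (h : T.evenCells.all evenEnclOK = true)
    (hodd : ∀ C ∈ T.oddCells, ∀ p ∈ T.box, ∀ Δ : ℝ, (C.lo : ℝ) ≤ Δ → Δ ≤ C.hi →
      ∀ (i : ℕ) (q : ℕ × ℕ) (I : (ℚ × ℚ) × (ℚ × ℚ) × (ℚ × ℚ)), C.F[i]? = some q → C.A[i]? = some I →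
        ((I.1.1 : ℝ) ≤ (oddCoeffs p.1 p.2 Δ C.ℓ q).1 ∧ (oddCoeffs p.1 p.2 Δ C.ℓ q).1 ≤ (I.1.2 : ℝ)) ∧
        ((I.2.1.1 : ℝ) ≤ (oddCoeffs p.1 p.2 Δ C.ℓ q).2.1 ∧ (oddCoeffs p.1 p.2 Δ C.ℓ q).2.1 ≤ (I.2.1.2 : ℝ)) ∧
        ((I.2.2.1 : ℝ) ≤ (oddCoeffs p.1 p.2 Δ C.ℓ q).2.2 ∧ (oddCoeffs p.1 p.2 Δ C.ℓ q).2.2 ≤ (I.2.2.2 : ℝ))) :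
    T.Enclosures :=
  ⟨T.evenEnclosures_of_check h, hodd⟩

end TaylorTable

end Summit.CriticalPhenomena.Ising3D
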